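/-
Copyright: the b2b-balaban T⁴-continuum CRUX team, row NE7b leaf lineage `t4-ne7b-formalise-leaf-02` (gen 134). Project licence.
-/
import Summits.QuantumFields.BalabanUV.T4Continuum.Spine.NE7b.SineTentAxis
import Summits.QuantumFields.BalabanUV.T4Continuum.Spine.NE7b.TentPartitionTorus

/-!
# THE SINE-TENT QUADRATIC PARTITION ON THE TORUS `(ℤ∕Nℤ)^d`: `h_S(ξ) = Π_ν sin(π∕2 · h(ξ_ν − (S_ν L + c)))` has `Σ_S h_S(ξ)² = 1` EXACTLY, values in `[0, 1]`,
# moves by at most `π∕(2L)` per unit move and by at most `D·π∕(2L)` along an `ℓ¹`-displacement of length `≤ D`, and on a term whose bonds sit at the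
# reference site or one forward unit move away at most `2^d` cubes vary — the three partition letters `hpart` ∕ `hlip` ∕ `hμ` of
# `…AdmissibleFloorSeminormTerms.ims_floor_of_linear_terms` WITHOUT the normalisation detour (row NE7b, node U5c; residual (R2′) family (2), letter (ℓ1))

Cell `pub-balaban`, sub-cell `t4`, spine estimate NE7b (`T4WeightBudget.RelWeightBound`; the cell's OWN estimate — NOT PRINTED in [Bałaban 1983–89],
NOT PROVED).  Crux-route work under `Spine/NE7b/`; NOTHING of Bałaban's estimates is asserted; no `def`; zero `sorry`; no `T4Continuum/Support` leaf
(FREEZE (0)).  Imports BY NAME: this lineage's `…SineTentAxis` (STA: `sum_sq_sin_tent_eq_one`, `sin_tent_nonneg` ∕ `_le_one`, the alive pairs,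
`abs_sin_tent_step_le`) and `…TentPartitionTorus` (TPTo: the generic chains `exists_chain`, `hdisp_of_unit`, `card_box_le`; through it leaf-05 g157's
`…TentPartitionProduct` — `sum_prod_eq_one`, `abs_prod_update_sub_le` — and this lineage's `…PartitionPathLetters` — `sum_sq_path_le_of_le`,
`card_alive_on_term_le_of_le`).

WHY.  See `…SineTentAxis`: print's `{h_□}` ([B6] Sect. A; SectE-interface-proof Prop. 5.6) is a QUADRATIC partition with `|h_□(b) − h_□(b′)| ≤ c_h|b − b′|∕M`; the
sine of the (3.40) tent realises it on the torus with `c_h = π∕2` per unit move, and AFST consumes it as is: `ε = μℓ²λ²ab` with `λ = Dπ∕(2L)` and, for the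
plaquette shape, `μ = 2^d` — no `4μ₀` from a normalisation, no `√2` from an `ℓ²` step.

WHAT IS PROVED ([folklore]; `0 < L`, `2 ≤ M`, `N = M·L`, offset `c`; `h_S(ξ) := Π_ν sin(π∕2·tentZ L (ξ ν − ((S ν).val·L + c)))` written out):
* §1 **`sum_sq_prod_sin_tent_eq_one`** (`Σ_S h_S(ξ)² = 1` — AFST's `hpart` EXACTLY: `(Π g)² = Π g²` and TPP `sum_prod_eq_one` on the squared axis family),
  `prod_sin_tent_nonneg` ∕ `_le_one`.
* §2 unit moves, pointwise: **`abs_prod_sin_tent_add_one_le`** ∕ **`…_sub_one_le`** (`|h_S(update ξ ν (ξ ν ± 1)) − h_S(ξ)| ≤ π∕(2L)`; TPP `abs_prod_update_sub_le`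
  ∘ STA `abs_sin_tent_step_le`).
* §3 chains, pointwise: **`abs_prod_sin_tent_sub_le_of_disp`** — AFST's `hlip` with `λ = D·π∕(2L)` for bonds read at sites `pt` with `ℓ¹`-witnesses `pt b =
  pt (ref j) + w⁺ − w⁻`, `Σw⁺ + Σw⁻ ≤ D` (TPTo `exists_chain` at `K = Unit` + PPaL `sum_sq_path_le_of_le`); `…_of_unit` (`λ = π∕(2L)` under `hunit`).
* §4 multiplicity: `filter_alive_prod_sin_tent_subset_box` ∕ `…_add_one_subset_box` (alive cubes at `ξ` and at `update ξ ν (ξ ν + 1)` lie in the tent's box of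
  `ξ`), **`card_varying_on_term_sin_tent_le_of_unit`** — AFST's `hμ` with `μ = 2^{#A}` in the plaquette shape; `card_varying_on_term_sin_tent_le` — the general
  shape `μ = (a+1)·2^{#A}` (PPaL `card_alive_on_term_le_of_le`).
* §5 toy: one axis, `M = 2`, `L = 1`: `Σ_S h_S² = 1` (`example` via §1).

NOT HERE (honest): the AFST junction itself (`…SineTentFloor`, one `exact`), the term data, the local floors; anything of Bałaban's estimates.
BY-NAME EFFECT ON THE WALL: NONE.  NE7b NOT PRINTED ∕ NOT PROVED; spine PROVED 0∕9; rung (B)+1 on ONE finite T⁴ — NOT infinite volume, NOT the mass gap, NOT Clay.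
HONEST DEPENDENCY: continuum YM on T⁴ ⇐ BetaPertH ∧ nine spine estimates (0/9 proved); BetaPertH ⇐ (D1) ∧ (D4) ∧ CAP+tail; G-an2-4 gates asym, D1 and NE2/3/4.
-/

set_option autoImplicit false

noncomputable section

open Finset
open Literature.MathematicalPhysics.QuantumFieldTheory.Balaban1983to89.B14.TentUnityTorus (tentZ)
open Summit.QuantumFields.BalabanUV.T4Continuum.NE7b.TentPartitionProduct (sum_prod_eq_one abs_prod_update_sub_le)
open Summit.QuantumFields.BalabanUV.T4Continuum.NE7b.PartitionPathLetters (sum_sq_path_le_of_le card_alive_on_term_le_of_le)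
open Summit.QuantumFields.BalabanUV.T4Continuum.NE7b.TentPartitionTorus (exists_chain hdisp_of_unit card_box_le)
open Summit.QuantumFields.BalabanUV.T4Continuum.NE7b.SineTentAxis (sin_tent_nonneg sin_tent_le_one sin_tent_eq_zero_iff sum_sq_sin_tent_eq_one
  filter_sin_tent_ne_zero_subset_pair filter_sin_tent_ne_zero_add_one_subset_pair abs_sin_tent_step_le)

namespace Summit.QuantumFields.BalabanUV.T4Continuum.NE7b.SineTentQuadraticPartition

variable {A : Type*} [Fintype A] [DecidableEq A]

/-! ## §1 The squares sum to one on the torus -/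

/-- **`Σ_S (Π_ν sin(π∕2·θ_{S_ν}(ξ_ν)))² = 1`** on `A → ZMod N` (`N = M·L`, `2 ≤ M`): `(Π g)² = Π g²`, then TPP `sum_prod_eq_one` for the axis family `g²`, which sums
to one by STA `sum_sq_sin_tent_eq_one` — AFST's `hpart`, exactly. [folklore] -/
theorem sum_sq_prod_sin_tent_eq_one (L M N : ℕ) [NeZero M] [NeZero N] (hL : 0 < L) (hM : 2 ≤ M) (hN : N = M * L) (c : ℕ) (ξ : A → ZMod N) :
    ∑ S : A → ZMod M, (∏ ν, Real.sin (Real.pi / 2 * tentZ (L : ℝ) (ξ ν - (((S ν).val * L + c : ℕ) : ZMod N)))) ^ 2 = 1 := by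
  have h := sum_prod_eq_one (A := A)
    (fun (b : ZMod M) (a : ZMod N) => Real.sin (Real.pi / 2 * tentZ (L : ℝ) (a - ((b.val * L + c : ℕ) : ZMod N))) ^ 2)
    (fun a => sum_sq_sin_tent_eq_one L M N hL hM hN c a) ξ
  refine Eq.trans (Finset.sum_congr rfl fun S _ => ?_) h
  exact (Finset.prod_pow _ 2 _).symm

omit [Fintype A] [DecidableEq A] in
/-- `0 ≤ h_S(ξ)`. [folklore] -/
theorem prod_sin_tent_nonneg (L N : ℕ) {M : ℕ} (hL : 0 < L) (c : ℕ) (S : A → ZMod M) (ξ : A → ZMod N) (T : Finset A) :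
    0 ≤ ∏ ν ∈ T, Real.sin (Real.pi / 2 * tentZ (L : ℝ) (ξ ν - (((S ν).val * L + c : ℕ) : ZMod N))) :=
  Finset.prod_nonneg fun _ _ => sin_tent_nonneg (by exact_mod_cast hL) _

omit [Fintype A] [DecidableEq A] in
/-- `h_S(ξ) ≤ 1`. [folklore] -/
theorem prod_sin_tent_le_one (L N : ℕ) {M : ℕ} (hL : 0 < L) (c : ℕ) (S : A → ZMod M) (ξ : A → ZMod N) (T : Finset A) :
    ∏ ν ∈ T, Real.sin (Real.pi / 2 * tentZ (L : ℝ) (ξ ν - (((S ν).val * L + c : ℕ) : ZMod N))) ≤ 1 :=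
  Finset.prod_le_one (fun _ _ => sin_tent_nonneg (by exact_mod_cast hL) _) fun _ _ => sin_tent_le_one _ _

/-! ## §2 Unit moves move `h_S` by at most `π∕(2L)`, pointwise -/

/-- **FORWARD UNIT MOVE, POINTWISE**: `|h_S(update ξ ν (ξ ν + 1)) − h_S(ξ)| ≤ π∕(2L)` (`2 ≤ M`, so `2 ≤ N`) — TPP `abs_prod_update_sub_le` (the off-axis factors lie in
`[0,1]`) then STA `abs_sin_tent_step_le`. [folklore] -/
theorem abs_prod_sin_tent_add_one_le (L M N : ℕ) [NeZero M] [NeZero N] (hL : 0 < L) (hM : 2 ≤ M) (hN : N = M * L) (c : ℕ)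
    (S : A → ZMod M) (ξ : A → ZMod N) (ν : A) :
    |∏ μ, Real.sin (Real.pi / 2 * tentZ (L : ℝ) (Function.update ξ ν (ξ ν + 1) μ - (((S μ).val * L + c : ℕ) : ZMod N)))
        - ∏ μ, Real.sin (Real.pi / 2 * tentZ (L : ℝ) (ξ μ - (((S μ).val * L + c : ℕ) : ZMod N)))| ≤ Real.pi / (2 * L) := by
  have hN2 : 2 ≤ N := by
    rw [hN]; calc 2 = 2 * 1 := by norm_num
      _ ≤ M * L := Nat.mul_le_mul hM hL
  exact (abs_prod_update_sub_le (fun (b : ZMod M) (a : ZMod N) => Real.sin (Real.pi / 2 * tentZ (L : ℝ) (a - ((b.val * L + c : ℕ) : ZMod N))))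
    (fun _ _ => sin_tent_nonneg (by exact_mod_cast hL) _) (fun _ _ => sin_tent_le_one _ _) S ξ ν (ξ ν + 1)).trans
    (abs_sin_tent_step_le L M N hL hN2 c (ξ ν) (S ν))

/-- **BACKWARD UNIT MOVE, POINTWISE**: `|h_S(update ξ ν (ξ ν − 1)) − h_S(ξ)| ≤ π∕(2L)`. [folklore] -/
theorem abs_prod_sin_tent_sub_one_le (L M N : ℕ) [NeZero M] [NeZero N] (hL : 0 < L) (hM : 2 ≤ M) (hN : N = M * L) (c : ℕ)
    (S : A → ZMod M) (ξ : A → ZMod N) (ν : A) :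
    |∏ μ, Real.sin (Real.pi / 2 * tentZ (L : ℝ) (Function.update ξ ν (ξ ν - 1) μ - (((S μ).val * L + c : ℕ) : ZMod N)))
        - ∏ μ, Real.sin (Real.pi / 2 * tentZ (L : ℝ) (ξ μ - (((S μ).val * L + c : ℕ) : ZMod N)))| ≤ Real.pi / (2 * L) := by
  set ξ' : A → ZMod N := Function.update ξ ν (ξ ν - 1) with hξ'
  have hback : Function.update ξ' ν (ξ' ν + 1) = ξ := by
    rw [hξ', Function.update_self, sub_add_cancel, Function.update_idem, Function.update_eq_self]
  have h := abs_prod_sin_tent_add_one_le L M N hL hM hN c S ξ' ν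
  rw [hback] at h
  rwa [abs_sub_comm] at h

/-! ## §3 Along an `ℓ¹`-displacement of length `≤ D`: AFST's pointwise Lipschitz letter `λ = D·π∕(2L)` -/

/-- **AFST's `hlip` ON THE TORUS**: bonds read at sites `pt`; if `pt b = pt (ref j) + w⁺ − w⁻` with `Σw⁺ + Σw⁻ ≤ D` for every bond `b ∈ inc j`, then for every cube
`S`, `|h_S(pt b) − h_S(pt (ref j))| ≤ D·π∕(2L)` — TPTo `exists_chain` for the ONE-cube family `K = Unit` with the squared unit-move letter `(π∕(2L))²`, then PPaL
`sum_sq_path_le_of_le` and a square root. [folklore] -/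
theorem abs_prod_sin_tent_sub_le_of_disp (L M N : ℕ) [NeZero M] [NeZero N] (hL : 0 < L) (hM : 2 ≤ M) (hN : N = M * L) (c : ℕ)
    {C J : Type*} (pt : C → A → ZMod N) (inc : J → Finset C) (ref : J → C) (D : ℕ)
    (hdisp : ∀ j, ∀ b ∈ inc j, ∃ wp wm : A → ℕ,
      pt b = pt (ref j) + (fun ν => ((wp ν : ℕ) : ZMod N)) - (fun ν => ((wm ν : ℕ) : ZMod N)) ∧ ∑ ν, wp ν + ∑ ν, wm ν ≤ D) :
    ∀ (S : A → ZMod M) (j : J), ∀ b ∈ inc j,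
      |∏ ν, Real.sin (Real.pi / 2 * tentZ (L : ℝ) (pt b ν - (((S ν).val * L + c : ℕ) : ZMod N)))
        - ∏ ν, Real.sin (Real.pi / 2 * tentZ (L : ℝ) (pt (ref j) ν - (((S ν).val * L + c : ℕ) : ZMod N)))| ≤ D * (Real.pi / (2 * L)) := by
  intro S j b hb
  have hLr : (0 : ℝ) < L := by exact_mod_cast hL
  have hβ : (0 : ℝ) ≤ Real.pi / (2 * L) := by positivity
  obtain ⟨wp, wm, hpt, hD⟩ := hdisp j b hb
  -- the one-cube column family
  obtain ⟨p, hp0, hpn, hps⟩ := exists_chain (K := Unit)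
    (fun (_ : Unit) (ζ : A → ZMod N) => ∏ ν, Real.sin (Real.pi / 2 * tentZ (L : ℝ) (ζ ν - (((S ν).val * L + c : ℕ) : ZMod N))))
    (β := (Real.pi / (2 * L)) ^ 2)
    (fun ζ ν => by
      simpa using pow_le_pow_left₀ (abs_nonneg _) (abs_prod_sin_tent_add_one_le L M N hL hM hN c S ζ ν) 2)
    (fun ζ ν => by
      simpa using pow_le_pow_left₀ (abs_nonneg _) (abs_prod_sin_tent_sub_one_le L M N hL hM hN c S ζ ν) 2)
    wp wm (pt (ref j))
  have hpath := sum_sq_path_le_of_le (K := Unit)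
    (fun (_ : Unit) (ζ : A → ZMod N) => ∏ ν, Real.sin (Real.pi / 2 * tentZ (L : ℝ) (ζ ν - (((S ν).val * L + c : ℕ) : ZMod N))))
    p hβ hD hps
  rw [hp0, hpn, ← hpt] at hpath
  simp only [Finset.univ_unique, Finset.sum_singleton] at hpath
  rw [← Real.sqrt_sq (mul_nonneg (Nat.cast_nonneg D) hβ), ← Real.sqrt_sq_eq_abs]
  exact Real.sqrt_le_sqrt hpath

/-- … **in the plaquette shape** (`hunit`: every bond at the reference site or ONE FORWARD unit move from it): `|h_S(pt b) − h_S(pt (ref j))| ≤ π∕(2L)`. [folklore] -/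
theorem abs_prod_sin_tent_sub_le_of_unit (L M N : ℕ) [NeZero M] [NeZero N] (hL : 0 < L) (hM : 2 ≤ M) (hN : N = M * L) (c : ℕ)
    {C J : Type*} (pt : C → A → ZMod N) (inc : J → Finset C) (ref : J → C)
    (hunit : ∀ j, ∀ b ∈ inc j, pt b = pt (ref j) ∨ ∃ ν, pt b = Function.update (pt (ref j)) ν (pt (ref j) ν + 1)) :
    ∀ (S : A → ZMod M) (j : J), ∀ b ∈ inc j,
      |∏ ν, Real.sin (Real.pi / 2 * tentZ (L : ℝ) (pt b ν - (((S ν).val * L + c : ℕ) : ZMod N)))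
        - ∏ ν, Real.sin (Real.pi / 2 * tentZ (L : ℝ) (pt (ref j) ν - (((S ν).val * L + c : ℕ) : ZMod N)))| ≤ Real.pi / (2 * L) := by
  intro S j b hb
  simpa using abs_prod_sin_tent_sub_le_of_disp L M N hL hM hN c pt inc ref 1 (hdisp_of_unit pt inc ref hunit) S j b hb

/-! ## §4 Multiplicity: the varying cubes on a term -/

/-- The alive cubes of `h` at `ξ` lie in the tent's box `Π_κ{q̄(ξ_κ), q̄(ξ_κ)+1}`. [folklore] -/
theorem filter_alive_prod_sin_tent_subset_box (L M N : ℕ) [NeZero M] [NeZero N] (hL : 0 < L) (hN : N = M * L) (c : ℕ) (ξ : A → ZMod N) :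
    (Finset.univ.filter fun S : A → ZMod M =>
        ∏ ν, Real.sin (Real.pi / 2 * tentZ (L : ℝ) (ξ ν - (((S ν).val * L + c : ℕ) : ZMod N))) ≠ 0)
      ⊆ Fintype.piFinset fun κ =>
        ({((((ξ κ - (c : ZMod N)).val / L : ℕ)) : ZMod M), ((((ξ κ - (c : ZMod N)).val / L : ℕ)) : ZMod M) + 1} : Finset (ZMod M)) := by
  intro S hS
  rw [Finset.mem_filter] at hS
  rw [Fintype.mem_piFinset]
  intro κ
  have hκ : Real.sin (Real.pi / 2 * tentZ (L : ℝ) (ξ κ - (((S κ).val * L + c : ℕ) : ZMod N))) ≠ 0 := fun h0 =>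
    hS.2 (Finset.prod_eq_zero (Finset.mem_univ κ) h0)
  exact filter_sin_tent_ne_zero_subset_pair L M N hL hN c (ξ κ) (Finset.mem_filter.mpr ⟨Finset.mem_univ _, hκ⟩)

/-- The alive cubes of `h` at `update ξ ν (ξ ν + 1)` lie in the SAME box of `ξ` (`2 ≤ M`). [folklore] -/
theorem filter_alive_prod_sin_tent_add_one_subset_box (L M N : ℕ) [NeZero M] [NeZero N] (hL : 0 < L) (hM : 2 ≤ M) (hN : N = M * L) (c : ℕ)
    (ξ : A → ZMod N) (ν : A) :
    (Finset.univ.filter fun S : A → ZMod M =>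
        ∏ κ, Real.sin (Real.pi / 2 * tentZ (L : ℝ) (Function.update ξ ν (ξ ν + 1) κ - (((S κ).val * L + c : ℕ) : ZMod N))) ≠ 0)
      ⊆ Fintype.piFinset fun κ =>
        ({((((ξ κ - (c : ZMod N)).val / L : ℕ)) : ZMod M), ((((ξ κ - (c : ZMod N)).val / L : ℕ)) : ZMod M) + 1} : Finset (ZMod M)) := by
  intro S hS
  rw [Finset.mem_filter] at hS
  rw [Fintype.mem_piFinset]
  intro κ
  have hκ : Real.sin (Real.pi / 2 * tentZ (L : ℝ) (Function.update ξ ν (ξ ν + 1) κ - (((S κ).val * L + c : ℕ) : ZMod N))) ≠ 0 := fun h0 =>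
    hS.2 (Finset.prod_eq_zero (Finset.mem_univ κ) h0)
  by_cases h : κ = ν
  · subst h
    rw [Function.update_self] at hκ
    exact filter_sin_tent_ne_zero_add_one_subset_pair L M N hL hM hN c (ξ κ) (Finset.mem_filter.mpr ⟨Finset.mem_univ _, hκ⟩)
  · rw [Function.update_of_ne h] at hκ
    exact filter_sin_tent_ne_zero_subset_pair L M N hL hN c (ξ κ) (Finset.mem_filter.mpr ⟨Finset.mem_univ _, hκ⟩)

/-- **AFST's `hμ` IN THE PLAQUETTE SHAPE**: under `hunit`, the cubes whose cutoff VARIES on the term (`h_S(pt b) ≠ h_S(pt (ref j))` for some bond) are alive at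
`pt b` or at `pt (ref j)`, hence in the one box of the reference site: `#{S : ∃ b ∈ inc j, h_S(pt b) ≠ h_S(pt (ref j))} ≤ 2^{#A}`. [folklore] -/
theorem card_varying_on_term_sin_tent_le_of_unit (L M N : ℕ) [NeZero M] [NeZero N] (hL : 0 < L) (hM : 2 ≤ M) (hN : N = M * L) (c : ℕ)
    {C J : Type*} (pt : C → A → ZMod N) (inc : J → Finset C) (ref : J → C)
    (hunit : ∀ j, ∀ b ∈ inc j, pt b = pt (ref j) ∨ ∃ ν, pt b = Function.update (pt (ref j)) ν (pt (ref j) ν + 1)) (j : J) :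
    (Finset.univ.filter fun S : A → ZMod M => ∃ b ∈ inc j,
        ∏ ν, Real.sin (Real.pi / 2 * tentZ (L : ℝ) (pt b ν - (((S ν).val * L + c : ℕ) : ZMod N)))
          ≠ ∏ ν, Real.sin (Real.pi / 2 * tentZ (L : ℝ) (pt (ref j) ν - (((S ν).val * L + c : ℕ) : ZMod N)))).card ≤ 2 ^ Fintype.card A := by
  classical
  refine (Finset.card_le_card ?_).trans (card_box_le M N L c (pt (ref j)))
  intro S hS
  rw [Finset.mem_filter] at hS
  obtain ⟨b, hb, hne⟩ := hS.2
  -- a varying cube is alive at `pt b` or at `pt (ref j)`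
  by_cases h0 : ∏ ν, Real.sin (Real.pi / 2 * tentZ (L : ℝ) (pt (ref j) ν - (((S ν).val * L + c : ℕ) : ZMod N))) ≠ 0
  · exact filter_alive_prod_sin_tent_subset_box L M N hL hN c (pt (ref j)) (Finset.mem_filter.mpr ⟨Finset.mem_univ _, h0⟩)
  · have h1 : ∏ ν, Real.sin (Real.pi / 2 * tentZ (L : ℝ) (pt b ν - (((S ν).val * L + c : ℕ) : ZMod N))) ≠ 0 := by
      intro h; exact hne (h.trans (not_not.mp h0).symm)
    rcases hunit j b hb with he | ⟨ν, hν⟩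
    · rw [he] at h1; exact absurd (not_not.mp h0) h1
    · rw [hν] at h1
      exact filter_alive_prod_sin_tent_add_one_subset_box L M N hL hM hN c (pt (ref j)) ν (Finset.mem_filter.mpr ⟨Finset.mem_univ _, h1⟩)

/-- **AFST's `hμ` IN THE GENERAL SHAPE**: `#{S : ∃ b ∈ inc j, h_S(pt b) ≠ h_S(pt (ref j))} ≤ (a + 1)·2^{#A}` for terms with `#inc j ≤ a` bonds (a varying cube is alive
at `pt b` or at `pt (ref j)`; PPaL `card_alive_on_term_le_of_le` with the per-site count `2^{#A}`). [folklore] -/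
theorem card_varying_on_term_sin_tent_le (L M N : ℕ) [NeZero M] [NeZero N] (hL : 0 < L) (hN : N = M * L) (c : ℕ)
    {C J : Type*} (pt : C → A → ZMod N) (inc : J → Finset C) (ref : J → C) {a : ℕ} (ha : ∀ j, (inc j).card ≤ a) (j : J) :
    (Finset.univ.filter fun S : A → ZMod M => ∃ b ∈ inc j,
        ∏ ν, Real.sin (Real.pi / 2 * tentZ (L : ℝ) (pt b ν - (((S ν).val * L + c : ℕ) : ZMod N)))
          ≠ ∏ ν, Real.sin (Real.pi / 2 * tentZ (L : ℝ) (pt (ref j) ν - (((S ν).val * L + c : ℕ) : ZMod N)))).card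
      ≤ (a + 1) * 2 ^ Fintype.card A := by
  classical
  have hsite : ∀ ξ : A → ZMod N, (Finset.univ.filter fun S : A → ZMod M =>
      ∏ ν, Real.sin (Real.pi / 2 * tentZ (L : ℝ) (ξ ν - (((S ν).val * L + c : ℕ) : ZMod N))) ≠ 0).card ≤ 2 ^ Fintype.card A :=
    fun ξ => (Finset.card_le_card (filter_alive_prod_sin_tent_subset_box L M N hL hN c ξ)).trans (card_box_le M N L c ξ)
  refine (Finset.card_le_card ?_).trans
    (card_alive_on_term_le_of_le
      (fun (S : A → ZMod M) (b : C) => ∏ ν, Real.sin (Real.pi / 2 * tentZ (L : ℝ) (pt b ν - (((S ν).val * L + c : ℕ) : ZMod N))))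
      (fun b => hsite (pt b)) inc ref ha j)
  refine Finset.monotone_filter_right _ fun S _ hS => ?_
  obtain ⟨b, hb, hne⟩ := hS
  refine ⟨b, hb, ?_⟩
  by_contra h0
  obtain ⟨h1, h2⟩ := not_or.mp h0
  exact hne ((not_not.mp h1).trans (not_not.mp h2).symm)

/-! ## §5 Toy: one axis, two cubes of one site -/

example (ξ : Unit → ZMod 2) :
    ∑ S : Unit → ZMod 2, (∏ ν, Real.sin (Real.pi / 2 * tentZ ((1 : ℕ) : ℝ) (ξ ν - (((S ν).val * 1 + 0 : ℕ) : ZMod 2)))) ^ 2 = 1 :=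
  sum_sq_prod_sin_tent_eq_one 1 2 2 one_pos le_rfl rfl 0 ξ

end Summit.QuantumFields.BalabanUV.T4Continuum.NE7b.SineTentQuadraticPartition

end
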